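import Summits.QuantumFields.YangMills.Theorems.FemtoTransferGapSpectralSumsRootPointwise
import HarnessLib

/-!
# BLOCK-TO-FINE ROOT INEQUALITIES, part 2: spectral-sum bookkeeping, Cauchy–Schwarz and MEANS COMPARABILITY (door `BlockToFine`, crux `DressedRitz`,
# stmt-QuantumFields-20205; LEAD prover ym-lead-20205-polyakovlift g4)

Let `λ_k ≥ 0`, `a_k` be real sequences and `S_p = Σ_k λ_k^p a_k²`, `A = Σ_k a_k²` (in the tree: `λ_k = levelValue`, `a_k = ⟨v,e_k⟩`, `S_p = ⟨v,K^p v⟩`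
for a physical `v`, `A ≤ ⟨v,v⟩` Bessel — `FemtoTransferGapSpectralSums`).  For a block length `ℓ ≥ 1` the RAW block defect is the relative variance of
`X = λ^ℓ` under the weights `a_k²` (`S_{2ℓ}·nv ≤ (1+δ)S_ℓ²`, `A ≤ nv`), the DRESSED block defect the one under `λ_k^{2ℓ}a_k²` (`S_{4ℓ}S_{2ℓ} ≤ (1+δ)S_{3ℓ}²`).

* `hasSum_raw_centred ∕ hasSum_dressed_centred ∕ hasSum_half_centred`: centred second moments as `HasSum`s;
* `Sl_sq_le`, `S2l_sq_le` (Cauchy–Schwarz), `raw_mean_le_dressed_mean`: `S_ℓ/A ≤ S_{3ℓ}/S_{2ℓ}`; `raw_var_le`, `dressed_var_le`;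
* ★ `means_cmp`: under both block defects with `δ ≤ 1/32`, `S_{3ℓ}/S_{2ℓ} < 4·S_ℓ/A` (the dressed mean is within a factor four of the raw mean).

HONEST FRAMING: real-analysis plumbing for the femto-universe infrastructure of the CONDITIONAL rung R2b1; nothing here bears on infinite volume, the
continuum limit or the Clay gap.  References: Reed–Simon IV, Thm. XIII.1 [cite: ReedSimonIV1978, Thm. XIII.1]; Chebyshev's inequality [folklore].
-/

set_option autoImplicit false

noncomputable section

open Finset
open scoped BigOperators

namespace Summit.QuantumFields.YangMills.Theorems.FemtoTransferGap.SpecSum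

open Root

variable {lam a : ℕ → ℝ} {ℓ : ℕ} {A nv Sl S2l S2l1 S2l2 S3l S4l δ : ℝ}

/-- `λ^{2ℓ} = (λ^ℓ)²`. [folklore] -/
theorem pow_two_mul_eq (x : ℝ) (ℓ : ℕ) : x ^ (2 * ℓ) = (x ^ ℓ) ^ 2 := by rw [pow_mul']

/-- `λ^{3ℓ} = (λ^ℓ)³`. [folklore] -/
theorem pow_three_mul_eq (x : ℝ) (ℓ : ℕ) : x ^ (3 * ℓ) = (x ^ ℓ) ^ 3 := by rw [pow_mul']

/-- `λ^{4ℓ} = (λ^ℓ)⁴`. [folklore] -/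
theorem pow_four_mul_eq (x : ℝ) (ℓ : ℕ) : x ^ (4 * ℓ) = (x ^ ℓ) ^ 4 := by rw [pow_mul']

/-- `λ^{2ℓ+1} = (λ^ℓ)²·λ`. [folklore] -/
theorem pow_two_mul_add_one_eq (x : ℝ) (ℓ : ℕ) : x ^ (2 * ℓ + 1) = (x ^ ℓ) ^ 2 * x := by rw [pow_succ, pow_mul']

/-- `λ^{2ℓ+2} = (λ^ℓ)²·λ²`. [folklore] -/
theorem pow_two_mul_add_two_eq (x : ℝ) (ℓ : ℕ) : x ^ (2 * ℓ + 2) = (x ^ ℓ) ^ 2 * x ^ 2 := by rw [pow_add, pow_mul']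

/-- If `S_{2ℓ} > 0` then the Bessel sum `A = Σ a_k²` is positive. [folklore] -/
theorem bessel_pos (hA : HasSum (fun k => a k ^ 2) A) (hS2l : HasSum (fun k => lam k ^ (2 * ℓ) * a k ^ 2) S2l) (hpos : 0 < S2l) :
    0 < A := by
  have hA0 : 0 ≤ A := hA.nonneg fun k => sq_nonneg _
  rcases hA0.eq_or_lt with h | h
  · exfalso
    have hz : (fun k => a k ^ 2) = 0 := (hasSum_zero_iff_of_nonneg fun k => sq_nonneg (a k)).1 (h ▸ hA)
    have hterm : (fun k => lam k ^ (2 * ℓ) * a k ^ 2) = 0 := by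
      funext k; have := congrFun hz k; simp only [Pi.zero_apply] at this ⊢; rw [this, mul_zero]
    rw [hterm] at hS2l
    have : S2l = 0 := hS2l.unique hasSum_zero
    linarith
  · exact h

/-- If `S_{2ℓ} > 0` then `S_ℓ > 0` (`ℓ ≥ 1`). [folklore] -/
theorem Sl_pos (hnn : ∀ k, 0 ≤ lam k) (hSl : HasSum (fun k => lam k ^ ℓ * a k ^ 2) Sl)
    (hS2l : HasSum (fun k => lam k ^ (2 * ℓ) * a k ^ 2) S2l) (hpos : 0 < S2l) : 0 < Sl := by
  have h0 : 0 ≤ Sl := hSl.nonneg fun k => mul_nonneg (pow_nonneg (hnn k) _) (sq_nonneg _)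
  rcases h0.eq_or_lt with h | h
  · exfalso
    have hz : (fun k => lam k ^ ℓ * a k ^ 2) = 0 :=
      (hasSum_zero_iff_of_nonneg fun k => mul_nonneg (pow_nonneg (hnn k) _) (sq_nonneg _)).1 (h ▸ hSl)
    have hterm : (fun k => lam k ^ (2 * ℓ) * a k ^ 2) = 0 := by
      funext k
      have := congrFun hz k
      simp only [Pi.zero_apply] at this ⊢
      rw [pow_two_mul_eq, sq, mul_assoc, this, mul_zero]
    rw [hterm] at hS2l
    have : S2l = 0 := hS2l.unique hasSum_zero
    linarith
  · exact h

/-- RAW centred second moment: `Σ a_k²(λ_k^ℓ − c)² = S_{2ℓ} − 2c S_ℓ + c² A`. [folklore] -/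
theorem hasSum_raw_centred (hA : HasSum (fun k => a k ^ 2) A) (hSl : HasSum (fun k => lam k ^ ℓ * a k ^ 2) Sl)
    (hS2l : HasSum (fun k => lam k ^ (2 * ℓ) * a k ^ 2) S2l) (c : ℝ) :
    HasSum (fun k => a k ^ 2 * (lam k ^ ℓ - c) ^ 2) (S2l - 2 * c * Sl + c ^ 2 * A) := by
  have h := (hS2l.sub (hSl.mul_left (2 * c))).add (hA.mul_left (c ^ 2))
  refine h.congr_fun fun k => ?_
  simp only [pow_two_mul_eq]; ring

/-- DRESSED centred second moment: `Σ λ_k^{2ℓ}a_k²(λ_k^ℓ − c)² = S_{4ℓ} − 2c S_{3ℓ} + c² S_{2ℓ}`. [folklore] -/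
theorem hasSum_dressed_centred (hS2l : HasSum (fun k => lam k ^ (2 * ℓ) * a k ^ 2) S2l)
    (hS3l : HasSum (fun k => lam k ^ (3 * ℓ) * a k ^ 2) S3l) (hS4l : HasSum (fun k => lam k ^ (4 * ℓ) * a k ^ 2) S4l) (c : ℝ) :
    HasSum (fun k => lam k ^ (2 * ℓ) * a k ^ 2 * (lam k ^ ℓ - c) ^ 2) (S4l - 2 * c * S3l + c ^ 2 * S2l) := by
  have h := (hS4l.sub (hS3l.mul_left (2 * c))).add (hS2l.mul_left (c ^ 2))
  refine h.congr_fun fun k => ?_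
  simp only [pow_two_mul_eq, pow_three_mul_eq, pow_four_mul_eq]; ring

/-- ONE-DRESSED centred second moment: `Σ λ_k^ℓ a_k²(λ_k^ℓ − c)² = S_{3ℓ} − 2c S_{2ℓ} + c² S_ℓ`. [folklore] -/
theorem hasSum_half_centred (hSl : HasSum (fun k => lam k ^ ℓ * a k ^ 2) Sl) (hS2l : HasSum (fun k => lam k ^ (2 * ℓ) * a k ^ 2) S2l)
    (hS3l : HasSum (fun k => lam k ^ (3 * ℓ) * a k ^ 2) S3l) (c : ℝ) :
    HasSum (fun k => lam k ^ ℓ * a k ^ 2 * (lam k ^ ℓ - c) ^ 2) (S3l - 2 * c * S2l + c ^ 2 * Sl) := by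
  have h := (hS3l.sub (hS2l.mul_left (2 * c))).add (hSl.mul_left (c ^ 2))
  refine h.congr_fun fun k => ?_
  simp only [pow_two_mul_eq, pow_three_mul_eq]; ring

/-- CAUCHY–SCHWARZ I: `S_ℓ² ≤ A · S_{2ℓ}`. [folklore] -/
theorem Sl_sq_le (hA : HasSum (fun k => a k ^ 2) A) (hSl : HasSum (fun k => lam k ^ ℓ * a k ^ 2) Sl)
    (hS2l : HasSum (fun k => lam k ^ (2 * ℓ) * a k ^ 2) S2l) (hpos : 0 < S2l) : Sl ^ 2 ≤ A * S2l := by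
  have hApos := bessel_pos hA hS2l hpos
  have h := (hasSum_raw_centred hA hSl hS2l (Sl / A)).nonneg fun k => mul_nonneg (sq_nonneg _) (sq_nonneg _)
  have hid : S2l - 2 * (Sl / A) * Sl + (Sl / A) ^ 2 * A = S2l - Sl ^ 2 / A := by field_simp; ring
  rw [hid, sub_nonneg, div_le_iff₀ hApos] at h
  linarith

/-- CAUCHY–SCHWARZ II: `S_{2ℓ}² ≤ S_ℓ · S_{3ℓ}`. [folklore] -/
theorem S2l_sq_le (hnn : ∀ k, 0 ≤ lam k) (hSl : HasSum (fun k => lam k ^ ℓ * a k ^ 2) Sl)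
    (hS2l : HasSum (fun k => lam k ^ (2 * ℓ) * a k ^ 2) S2l) (hS3l : HasSum (fun k => lam k ^ (3 * ℓ) * a k ^ 2) S3l)
    (hpos : 0 < S2l) : S2l ^ 2 ≤ Sl * S3l := by
  have hSlpos := Sl_pos hnn hSl hS2l hpos
  have h := (hasSum_half_centred hSl hS2l hS3l (S2l / Sl)).nonneg fun k =>
    mul_nonneg (mul_nonneg (pow_nonneg (hnn k) _) (sq_nonneg _)) (sq_nonneg _)
  have hid : S3l - 2 * (S2l / Sl) * S2l + (S2l / Sl) ^ 2 * Sl = S3l - S2l ^ 2 / Sl := by field_simp; ring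
  rw [hid, sub_nonneg, div_le_iff₀ hSlpos] at h
  linarith

/-- `S_{3ℓ} > 0` when `S_{2ℓ} > 0`. [folklore] -/
theorem S3l_pos (hnn : ∀ k, 0 ≤ lam k) (hSl : HasSum (fun k => lam k ^ ℓ * a k ^ 2) Sl)
    (hS2l : HasSum (fun k => lam k ^ (2 * ℓ) * a k ^ 2) S2l) (hS3l : HasSum (fun k => lam k ^ (3 * ℓ) * a k ^ 2) S3l)
    (hpos : 0 < S2l) : 0 < S3l := by
  have h := S2l_sq_le hnn hSl hS2l hS3l hpos
  have hSlpos := Sl_pos hnn hSl hS2l hpos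
  have h3 : 0 ≤ S3l := hS3l.nonneg fun k => mul_nonneg (pow_nonneg (hnn k) _) (sq_nonneg _)
  rcases h3.eq_or_lt with h0 | h0
  · exfalso; rw [← h0, mul_zero] at h; nlinarith
  · exact h0

/-- RAW MEAN ≤ DRESSED MEAN: `S_ℓ/A ≤ S_{3ℓ}/S_{2ℓ}` (two Cauchy–Schwarz steps). [folklore] -/
theorem raw_mean_le_dressed_mean (hnn : ∀ k, 0 ≤ lam k) (hA : HasSum (fun k => a k ^ 2) A)
    (hSl : HasSum (fun k => lam k ^ ℓ * a k ^ 2) Sl) (hS2l : HasSum (fun k => lam k ^ (2 * ℓ) * a k ^ 2) S2l)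
    (hS3l : HasSum (fun k => lam k ^ (3 * ℓ) * a k ^ 2) S3l) (hpos : 0 < S2l) : Sl / A ≤ S3l / S2l := by
  have hApos := bessel_pos hA hS2l hpos
  have hSlpos := Sl_pos hnn hSl hS2l hpos
  have h1 := Sl_sq_le hA hSl hS2l hpos
  have h2 := S2l_sq_le hnn hSl hS2l hS3l hpos
  rw [div_le_div_iff₀ hApos hpos]
  -- Sl² S2l² ≤ (A S2l)(Sl S3l) ⇒ Sl S2l ≤ A S3l
  have h3 : (Sl * S2l) ^ 2 ≤ (S3l * A) * (Sl * S2l) := by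
    calc (Sl * S2l) ^ 2 = Sl ^ 2 * S2l ^ 2 := by ring
      _ ≤ (A * S2l) * (Sl * S3l) := mul_le_mul h1 h2 (sq_nonneg _) (by positivity)
      _ = (S3l * A) * (Sl * S2l) := by ring
  have h4 : 0 < Sl * S2l := mul_pos hSlpos hpos
  have h5 : Sl * S2l * (Sl * S2l) ≤ S3l * A * (Sl * S2l) := by rw [← pow_two]; exact h3
  exact le_of_mul_le_mul_right h5 h4

/-- RAW DEFECT, centred form: `S_{2ℓ} − S_ℓ²/A ≤ δ S_ℓ²/A ≤ δ S_{2ℓ}` from `S_{2ℓ}·nv ≤ (1+δ)S_ℓ²`, `A ≤ nv`. [folklore] -/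
theorem raw_var_le (hA : HasSum (fun k => a k ^ 2) A) (hSl : HasSum (fun k => lam k ^ ℓ * a k ^ 2) Sl)
    (hS2l : HasSum (fun k => lam k ^ (2 * ℓ) * a k ^ 2) S2l) (hpos : 0 < S2l) (hAnv : A ≤ nv) (hδ0 : 0 ≤ δ)
    (H1 : S2l * nv ≤ (1 + δ) * Sl ^ 2) :
    S2l - 2 * (Sl / A) * Sl + (Sl / A) ^ 2 * A ≤ δ * S2l := by
  have hApos := bessel_pos hA hS2l hpos
  have hcs := Sl_sq_le hA hSl hS2l hpos
  have hid : S2l - 2 * (Sl / A) * Sl + (Sl / A) ^ 2 * A = (S2l * A - Sl ^ 2) / A := by field_simp; ring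
  rw [hid, div_le_iff₀ hApos]
  have h1 : S2l * A ≤ S2l * nv := mul_le_mul_of_nonneg_left hAnv hpos.le
  -- S2l A − Sl² ≤ δ Sl² ≤ δ A S2l
  nlinarith [mul_le_mul_of_nonneg_left hcs hδ0]

/-- DRESSED DEFECT, centred form: `S_{4ℓ} − S_{3ℓ}²/S_{2ℓ} ≤ δ S_{3ℓ}²/S_{2ℓ}` from `S_{4ℓ}S_{2ℓ} ≤ (1+δ)S_{3ℓ}²`. [folklore] -/
theorem dressed_var_le (hpos : 0 < S2l) (H2 : S4l * S2l ≤ (1 + δ) * S3l ^ 2) :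
    S4l - 2 * (S3l / S2l) * S3l + (S3l / S2l) ^ 2 * S2l ≤ δ * ((S3l / S2l) ^ 2 * S2l) := by
  have hid : S4l - 2 * (S3l / S2l) * S3l + (S3l / S2l) ^ 2 * S2l = (S4l * S2l - S3l ^ 2) / S2l := by field_simp; ring
  have hid2 : δ * ((S3l / S2l) ^ 2 * S2l) = δ * S3l ^ 2 / S2l := by field_simp
  rw [hid, hid2, div_le_div_iff_of_pos_right hpos]
  linarith

/-- ★ MEANS COMPARABILITY: under both block defects with `δ ≤ 1/32`, the dressed mean is below four raw means, `S_{3ℓ}/S_{2ℓ} < 4 S_ℓ/A`.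
[cite: ReedSimonIV1978, Thm. XIII.1] -/
theorem means_cmp (hnn : ∀ k, 0 ≤ lam k) (hA : HasSum (fun k => a k ^ 2) A) (hSl : HasSum (fun k => lam k ^ ℓ * a k ^ 2) Sl)
    (hS2l : HasSum (fun k => lam k ^ (2 * ℓ) * a k ^ 2) S2l) (hS3l : HasSum (fun k => lam k ^ (3 * ℓ) * a k ^ 2) S3l)
    (hS4l : HasSum (fun k => lam k ^ (4 * ℓ) * a k ^ 2) S4l) (hpos : 0 < S2l) (hAnv : A ≤ nv) (hδ0 : 0 ≤ δ) (hδ : δ ≤ 1 / 32)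
    (H1 : S2l * nv ≤ (1 + δ) * Sl ^ 2) (H2 : S4l * S2l ≤ (1 + δ) * S3l ^ 2) : S3l / S2l < 4 * (Sl / A) := by
  have hApos := bessel_pos hA hS2l hpos
  have hSlpos := Sl_pos hnn hSl hS2l hpos
  have hS3lpos := S3l_pos hnn hSl hS2l hS3l hpos
  have hm0 : 0 ≤ Sl / A := div_nonneg hSlpos.le hApos.le
  by_contra hcon
  have h4 : 4 * (Sl / A) ≤ S3l / S2l := not_lt.1 hcon
  set m := Sl / A with hm
  set Xb := S3l / S2l with hXb
  -- sum the pointwise comparability inequality with weights a_k²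
  have hL : HasSum (fun k => a k ^ 2 * ((lam k ^ ℓ) ^ 2 * Xb ^ 2)) (Xb ^ 2 * S2l) := by
    have := hS2l.mul_left (Xb ^ 2)
    refine this.congr_fun fun k => ?_
    simp only [pow_two_mul_eq]; ring
  have hR : HasSum (fun k => a k ^ 2 * (4 * ((lam k ^ ℓ) ^ 2 * (lam k ^ ℓ - Xb) ^ 2) + 4 * (Xb ^ 2 * (lam k ^ ℓ - m) ^ 2)))
      (4 * (S4l - 2 * Xb * S3l + Xb ^ 2 * S2l) + 4 * (Xb ^ 2 * (S2l - 2 * m * Sl + m ^ 2 * A))) := by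
    have := ((hasSum_dressed_centred hS2l hS3l hS4l Xb).mul_left 4).add
      (((hasSum_raw_centred hA hSl hS2l m).mul_left (Xb ^ 2)).mul_left 4)
    refine this.congr_fun fun k => ?_
    simp only [pow_two_mul_eq]; ring
  have hle := hasSum_le (fun k => mul_le_mul_of_nonneg_left (cmp_pointwise (pow_nonneg (hnn k) ℓ) hm0 h4) (sq_nonneg (a k))) hL hR
  have hV1 := raw_var_le hA hSl hS2l hpos hAnv hδ0 H1
  have hV2 := dressed_var_le hpos H2
  rw [← hm] at hV1
  rw [← hXb] at hV2
  -- Xb² S2l ≤ 4 δ Xb² S2l + 4 Xb² δ S2l = 8 δ Xb² S2l ⇒ (1 − 8δ) Xb² S2l ≤ 0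
  have hXb2 : 0 < Xb ^ 2 * S2l := mul_pos (pow_pos (div_pos hS3lpos hpos) 2) hpos
  nlinarith [mul_le_mul_of_nonneg_left hV1 (by positivity : (0 : ℝ) ≤ 4 * Xb ^ 2)]

end Summit.QuantumFields.YangMills.Theorems.FemtoTransferGap.SpecSum

end
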